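import Summits.NavierStokesRegularity.NavierStokesRegularity.Theorems.PerpetualPumpAveragedTypeIBlowupPreBootModes
import Summits.NavierStokesRegularity.NavierStokesRegularity.Theorems.PerpetualPumpAveragedTypeIBlowupPreBootRegime
import Summits.NavierStokesRegularity.NavierStokesRegularity.Theorems.PerpetualPumpAveragedTypeIBlowupSlavedLadder

/-!
# Crux `PerpetualPump.AveragedTypeIBlowup` (stmt-NavierStokesRegularity-1835), line `Sketch`:
# stub `preBoot` — the slaved ladder under the loose induction hypothesis

Fourth file of the proof of the registered stub `stub_preBoot`. On a pre-ignition horizon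
`[t₀, S]` the modes two or more scales above the front stay under the profile
`lad j = ε̄ (1+ε₀)^{-19(j-2)}` (`preBoot_ladder`, registered tools sub-goal): `stub_slavedLadder`
in the front clock with the box `X = MX = MY = lad`, `Y = lad/5` (`Y₁ = 2.2 ε̄` from the loose
level-1 bond), whose closure under the forcings is the elementary `preBoot_ladder_closure`
(adjacent rungs differ by at most the factor `(1+ε₀)^{19} ≤ 3`). Also the base of the induction:
the tight boxes at the hand-off time from the invariant alone (`preBoot_pre_t0`, registered
tools sub-goal).

## References

T. Tao, *Finite time blowup for an averaged three-dimensional Navier–Stokes equation*, J. Amer.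
Math. Soc. 29 (2016), 601–674, §5–6 (the cascade / circuit heuristics); the estimates are
folklore ODE bookkeeping.
-/

noncomputable section

-- the summit namespace `…NavierStokesRegularity.NavierStokesRegularity…` is the tree convention
set_option linter.dupNamespace false

open Set MeasureTheory Filter Topology

namespace Summit.NavierStokesRegularity.NavierStokesRegularity.Theorems.PerpetualPumpAveragedTypeIBlowup
/-- **Closure of the ladder box under the forcings** (the four algebraic inequalities of
`stub_slavedLadder` for the profile box `X = MX = MY = L`, `Y = L/5` at one rung, given the rung
below contributes `Yp² ≤ 5 ε̄ L` and the rung above `Lp ≤ ε̄`; `L ≤ ε̄ ≤ 10⁻⁶`, `η ≤ 10⁻⁹`).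
[folklore] -/
theorem preBoot_ladder_closure {L Lp Yp εb η θ q : ℝ} (hθ : 1 / 2 ≤ θ) (hq : 1 ≤ q)
    (hη : η ≤ 1 / 10 ^ 9) (hεb : 0 < εb) (hεb6 : εb ≤ 1 / 10 ^ 6) (hL : 0 ≤ L)
    (hLε : L ≤ εb) (hLp : 0 ≤ Lp) (hLpε : Lp ≤ εb) (hYp : Yp ^ 2 ≤ 5 * εb * L) :
    Yp ^ 2 / q ^ 3 + (L / 5) ^ 2 + εb * L * (L / 5) + η * L ≤ L / 2 ∧
    εb * L ^ 2 + η * L ≤ L / 5 / 4 ∧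
    (Yp ^ 2 / q ^ 3 + (L / 5) ^ 2 + εb * L * (L / 5)) / θ ≤ L / 2 ∧
    (L / 5 * (L + Lp / q + 1) + εb * L ^ 2) / θ ≤ L / 2 := by
  have hθ0 : 0 < θ := by linarith
  have hq0 : 0 < q := by linarith
  have hYp' : Yp ^ 2 / q ^ 3 ≤ 5 * εb * L :=
    (div_le_self (sq_nonneg _) (one_le_pow₀ hq)).trans hYp
  have hεL : εb * L ≤ 1 / 10 ^ 6 * L := mul_le_mul_of_nonneg_right hεb6 hL
  have hLL : L * L ≤ 1 / 10 ^ 6 * L := (mul_le_mul_of_nonneg_right hLε hL).trans hεL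
  have hηL : η * L ≤ 1 / 10 ^ 9 * L := mul_le_mul_of_nonneg_right hη hL
  have hεLL : εb * L * L ≤ 1 / 10 ^ 6 * L := by
    have h1 : εb * (L * L) ≤ 1 * (L * L) :=
      mul_le_mul_of_nonneg_right (by linarith [hεb6]) (mul_self_nonneg _)
    have h2 : εb * L * L = εb * (L * L) := by ring
    linarith
  have hLq : Lp / q ≤ εb := (div_le_self hLp hq).trans hLpε
  have hLLq : L * (Lp / q) ≤ 1 / 10 ^ 6 * L := by
    have h1 : L * (Lp / q) ≤ L * εb := mul_le_mul_of_nonneg_left hLq hL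
    linarith
  have e1 : (L / 5) ^ 2 = L * L / 25 := by ring
  have e2 : εb * L * (L / 5) = εb * L * L / 5 := by ring
  have e3 : εb * L ^ 2 = εb * L * L := by ring
  have e4 : L / 5 * (L + Lp / q + 1) = L * L / 5 + L * (Lp / q) / 5 + L / 5 := by ring
  have hθL : L / 4 ≤ L / 2 * θ := by nlinarith
  refine ⟨?_, ?_, ?_, ?_⟩
  · rw [e1, e2]
    linarith
  · rw [e3]
    linarith
  · rw [div_le_iff₀ hθ0, e1, e2]
    linarith
  · rw [div_le_iff₀ hθ0, e4, e3]
    linarith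

/-- **The slaved ladder under the loose induction hypothesis.** On `[t₀, S]`: if the level-1
bond is loosely small (`|w_{n+1}| ≤ 2.2 ε̄`), the modes `j ≥ 2` scales above the front stay under
the profile `lad` (`|b| ≤ lad j`, `|w| ≤ lad j / 5`, majorants `≤ lad j`): `stub_slavedLadder`
in the front clock with `X = MX = MY = lad`, `Y = lad/5` (`Y₁ = 2.2 ε̄`), relative rates
`(1+ε₀)^{2j}`, the far tail from the a-priori tail hypothesis and the initial box from the
hand-off invariant. Registered tools sub-goal `preBoot_ladder` of the stub `preBoot`. [folklore] -/
theorem preBoot_ladder :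
    ∀ (ε₀ D εb θ η F bhi q T t₀ S : ℝ) (n : ℤ) (lad : ℕ → ℝ)
      (bv wv M0 M1 db dw G0 G1 : ℤ → ℝ → ℝ) (R : ℤ → ℝ),
      (q = Real.sqrt (1 + ε₀)) →
      (∀ k : ℤ, R k = D * (1 + ε₀) ^ (2 * k)) →
      (∀ j : ℕ, lad j = εb * ((1 + ε₀) ^ (19 * (j - 2)))⁻¹) →
      (∀ (k : ℤ) (t : ℝ), G0 k t = (wv (k - 1) t) ^ 2 / q ^ 3 - (wv k t) ^ 2 - εb * bv k t * wv k t) →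
      (∀ (k : ℤ) (t : ℝ), G1 k t = wv k t * (bv k t - bv (k + 1) t / q) + εb * (bv k t) ^ 2) →
      (0 < ε₀) →
      (ε₀ ≤ 1 / 20) →
      (0 < D) →
      (1 / 2 ≤ θ) →
      (θ ≤ 1) →
      (0 ≤ η) →
      (0 < εb) →
      (εb ≤ 1 / 10 ^ 6) →
      (0 ≤ F) →
      (1 ≤ bhi + 4) →
      (η * (10 ^ 9 * (bhi + 4) ^ 4 * (F + 1)) ≤ 1) →
      (∀ k : ℤ, ContinuousOn (bv k) (Icc 0 T) ∧ ContinuousOn (wv k) (Icc 0 T) ∧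
        ContinuousOn (M0 k) (Icc 0 T) ∧ ContinuousOn (M1 k) (Icc 0 T)) →
      (∀ k : ℤ, ContinuousOn (db k) (Icc 0 T) ∧ ContinuousOn (dw k) (Icc 0 T) ∧
        ∀ t ∈ Ioo 0 T, HasDerivAt (bv k) (db k t) t ∧
        |db k t - R k * (-(bv k t) + G0 k t)| ≤ η * R k * M0 k t ∧
        HasDerivAt (wv k) (dw k t) t ∧ |dw k t - R k * (-(wv k t) + G1 k t)| ≤ η * R k * M1 k t) →
      (∀ k : ℤ, ∀ t ∈ Icc 0 T, |bv k t| ≤ M0 k t ∧ |wv k t| ≤ M1 k t ∧ 0 ≤ M0 k t ∧ 0 ≤ M1 k t) →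
      (∀ k : ℤ, ∀ t₁ ∈ Icc 0 T, ∀ t₂ ∈ Icc t₁ T,
        M0 k t₂ ≤ M0 k t₁ * Real.exp (-(θ * R k * (t₂ - t₁))) +
        R k * ∫ u in t₁..t₂, Real.exp (-(θ * R k * (t₂ - u))) * |G0 k u| ∧
        M1 k t₂ ≤ M1 k t₁ * Real.exp (-(θ * R k * (t₂ - t₁))) +
        R k * ∫ u in t₁..t₂, Real.exp (-(θ * R k * (t₂ - u))) * |G1 k u|) →
      (0 < T) →
      (0 ≤ t₀) →
      (t₀ ≤ S) →
      (S ≤ T) →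
      (∃ J : ℕ, ∀ j : ℕ, J ≤ j → ∀ t ∈ Icc 0 T,
        |bv (n + j) t| ≤ lad j ∧ |wv (n + j) t| ≤ lad j / 5 ∧ M0 (n + j) t ≤ lad j ∧ M1 (n + j) t ≤ lad j) →
      (∀ j : ℕ, 2 ≤ j → |bv (n + j) t₀| ≤ lad j ∧ |wv (n + j) t₀| ≤ lad j / 5 ∧
        M0 (n + j) t₀ ≤ lad j ∧ M1 (n + j) t₀ ≤ lad j) →
      (∀ u ∈ Icc t₀ S, |wv (n + 1) u| ≤ 22 / 10 * εb) →
      ∀ j : ℕ, 2 ≤ j → ∀ u ∈ Icc t₀ S, |bv (n + j) u| ≤ lad j ∧ |wv (n + j) u| ≤ lad j / 5 ∧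
      M0 (n + j) u ≤ lad j ∧ M1 (n + j) u ≤ lad j := by
  intro ε₀ D εb θ η F bhi q T t₀ S n lad bv wv M0 M1 db dw G0 G1 R hq hR hlad hG0 hG1 hε₀ hε₀' hD
    hθ hθ1 hη hεb hεb6 hF0 hbhi hηreg hcont hC1 hmaj hrest hT ht₀ hS hST hTail hInvL hL1
  obtain ⟨hRpos, -, -, -, -, hκ1, -, -, -, hq0, hq2⟩ := preBoot_rates hε₀ hε₀' hD hR hq n
  have hq1 : 1 ≤ q := by nlinarith
  have hRn := hRpos n
  obtain ⟨hη9, -⟩ := preBoot_eta hη hF0 hbhi hηreg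
  obtain ⟨J, hJ⟩ := hTail
  -- slow time of the front
  set S' := R n * (S - t₀) with hS'
  have hS'0 : 0 ≤ S' := mul_nonneg hRn.le (by linarith)
  have hST' : t₀ + S' / R n ≤ T := by
    rw [hS', mul_div_cancel_left₀ _ hRn.ne']
    linarith
  have hpk := fun k : ℤ =>
    handoff_sysPkg (k := k) hG0 hG1 hcont hC1 hmaj hrest hRn hT ht₀ hS'0 hST'
  obtain ⟨hmem, -⟩ := preBoot_push (tb := t₀) (s₁ := S) hRn
  obtain ⟨-, -, ht00⟩ := preBoot_time (tb := t₀) hRn.ne'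
  have hmemT : ∀ σ ∈ Icc 0 S', t₀ + σ / R n ∈ Icc 0 T := fun σ hσ =>
    ⟨ht₀.trans (hmem σ hσ).1, (hmem σ hσ).2.trans hST⟩
  -- the profile
  have hpow1 : ∀ i : ℕ, 1 ≤ (1 + ε₀) ^ i := fun i => one_le_pow₀ (by linarith)
  have hlad0 : ∀ j : ℕ, 0 < lad j := fun j => by
    rw [hlad]
    exact mul_pos hεb (inv_pos.2 (lt_of_lt_of_le zero_lt_one (hpow1 _)))
  have hladε : ∀ j : ℕ, lad j ≤ εb := fun j => by
    rw [hlad]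
    exact mul_le_of_le_one_right hεb.le (inv_le_one_of_one_le₀ (hpow1 _))
  have hlad2 : lad 2 = εb := by rw [hlad]; norm_num
  have hladsucc : ∀ j : ℕ, 2 ≤ j → lad j ≤ 3 * lad (j + 1) := by
    intro j hj
    have h19 := preBoot_pow19 hε₀.le hε₀'
    rw [hlad, hlad, show 19 * (j + 1 - 2) = 19 * (j - 2) + 19 by omega, pow_add, mul_inv,
      ← mul_assoc]
    have hA : 0 < εb * ((1 + ε₀) ^ (19 * (j - 2)))⁻¹ :=
      mul_pos hεb (inv_pos.2 (lt_of_lt_of_le zero_lt_one (hpow1 _)))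
    have hB : 1 ≤ 3 * ((1 + ε₀) ^ 19)⁻¹ := by
      rw [← div_eq_mul_inv, le_div_iff₀ (lt_of_lt_of_le zero_lt_one (hpow1 _))]
      linarith
    nlinarith
  -- the bond box: `lad j / 5` for `j ≠ 1`, `2.2 ε̄` for `j = 1`
  obtain ⟨Y, hY1, hYj⟩ : ∃ Y : ℕ → ℝ, Y 1 = 22 / 10 * εb ∧ ∀ j : ℕ, j ≠ 1 → Y j = lad j / 5 :=
    ⟨fun j => if j = 1 then 22 / 10 * εb else lad j / 5, if_pos rfl, fun j hj => if_neg hj⟩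
  have hY0 : ∀ j : ℕ, 0 ≤ Y j := fun j => by
    rcases eq_or_ne j 1 with h | h
    · rw [h, hY1]
      positivity
    · rw [hYj j h]
      exact div_nonneg (hlad0 j).le (by norm_num)
  have hYsq : ∀ j : ℕ, 2 ≤ j → Y (j - 1) ^ 2 ≤ 5 * εb * lad j := by
    intro j hj
    rcases eq_or_lt_of_le hj with h | h
    · subst h
      rw [show (2 : ℕ) - 1 = 1 from rfl, hY1, hlad2]
      nlinarith
    · rw [hYj (j - 1) (by omega)]
      have h3 := hladsucc (j - 1) (by omega)
      rw [show j - 1 + 1 = j by omega] at h3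
      have h0 := (hlad0 (j - 1)).le
      have : (lad (j - 1) / 5) ^ 2 ≤ (3 * lad j / 5) ^ 2 :=
        pow_le_pow_left₀ (by positivity) (by linarith) 2
      nlinarith [hladε j, (hlad0 j).le]
  have hcl : ∀ j : ℕ, 2 ≤ j →
      Y (j - 1) ^ 2 / q ^ 3 + Y j ^ 2 + εb * lad j * Y j + η * lad j ≤ lad j / 2 ∧
      εb * lad j ^ 2 + η * lad j ≤ Y j / 4 ∧
      (Y (j - 1) ^ 2 / q ^ 3 + Y j ^ 2 + εb * lad j * Y j) / θ ≤ lad j / 2 ∧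
      (Y j * (lad j + lad (j + 1) / q + 1) + εb * lad j ^ 2) / θ ≤ lad j / 2 := by
    intro j hj
    rw [hYj j (by omega)]
    exact preBoot_ladder_closure hθ hq1 hη9 hεb hεb6 (hlad0 j).le (hladε j) (hlad0 _).le
      (hladε _) (hYsq j hj)
  -- index casts
  have hc1 : ∀ j : ℕ, 2 ≤ j → (n : ℤ) + (j : ℤ) - 1 = n + ((j - 1 : ℕ) : ℤ) := fun j hj => by omega
  have hc2 : ∀ j : ℕ, (n : ℤ) + (j : ℤ) + 1 = n + ((j + 1 : ℕ) : ℤ) := fun j => by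
    push_cast
    ring
  -- hypotheses of `stub_slavedLadder`
  have h1 : ∀ j : ℕ, 2 ≤ j → ∀ σ ∈ Ioo 0 S', HasDerivAt (fun s => bv (n + j) (t₀ + s / R n))
      (R (n + j) / R n * (-(bv (n + j) (t₀ + σ / R n)) +
        (wv (n + ((j - 1 : ℕ) : ℤ)) (t₀ + σ / R n)) ^ 2 / q ^ 3 - (wv (n + j) (t₀ + σ / R n)) ^ 2 -
        εb * bv (n + j) (t₀ + σ / R n) * wv (n + j) (t₀ + σ / R n)) +
        (db (n + j) (t₀ + σ / R n) -
          R (n + j) * (-(bv (n + j) (t₀ + σ / R n)) + G0 (n + j) (t₀ + σ / R n))) / R n) σ := by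
    intro j hj σ hσ
    refine ((hpk (n + j)).1.2.2.2.2.1 σ hσ).congr_deriv ?_
    rw [hG0, hc1 j hj]
    ring
  have h2 : ∀ j : ℕ, 2 ≤ j → ∀ σ ∈ Ioo 0 S', HasDerivAt (fun s => wv (n + j) (t₀ + s / R n))
      (R (n + j) / R n * (wv (n + j) (t₀ + σ / R n) *
          (bv (n + j) (t₀ + σ / R n) - bv (n + ((j + 1 : ℕ) : ℤ)) (t₀ + σ / R n) / q - 1) +
        εb * (bv (n + j) (t₀ + σ / R n)) ^ 2) +
        (dw (n + j) (t₀ + σ / R n) -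
          R (n + j) * (-(wv (n + j) (t₀ + σ / R n)) + G1 (n + j) (t₀ + σ / R n))) / R n) σ := by
    intro j _ σ hσ
    refine ((hpk (n + j)).2.2.2.2.2.1 σ hσ).congr_deriv ?_
    rw [hG1, hc2 j]
    ring
  have h3 : ∀ j : ℕ, 2 ≤ j → ∀ σ ∈ Icc 0 S', 0 ≤ M0 (n + j) (t₀ + σ / R n) ∧
      M0 (n + j) (t₀ + σ / R n) ≤ M0 (n + j) (t₀ + 0 / R n) * Real.exp (-(θ * (R (n + j) / R n) * σ)) +
        R (n + j) / R n * ∫ u in (0 : ℝ)..σ, Real.exp (-(θ * (R (n + j) / R n) * (σ - u))) *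
          |(wv (n + ((j - 1 : ℕ) : ℤ)) (t₀ + u / R n)) ^ 2 / q ^ 3 - (wv (n + j) (t₀ + u / R n)) ^ 2 -
            εb * bv (n + j) (t₀ + u / R n) * wv (n + j) (t₀ + u / R n)| := by
    intro j hj σ hσ
    have := (hpk (n + j)).1.2.2.2.2.2.2 σ hσ
    simp only [hG0, hc1 j hj] at this
    exact this
  have h4 : ∀ j : ℕ, 2 ≤ j → ∀ σ ∈ Icc 0 S', 0 ≤ M1 (n + j) (t₀ + σ / R n) ∧
      M1 (n + j) (t₀ + σ / R n) ≤ M1 (n + j) (t₀ + 0 / R n) * Real.exp (-(θ * (R (n + j) / R n) * σ)) +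
        R (n + j) / R n * ∫ u in (0 : ℝ)..σ, Real.exp (-(θ * (R (n + j) / R n) * (σ - u))) *
          |wv (n + j) (t₀ + u / R n) *
              (bv (n + j) (t₀ + u / R n) - bv (n + ((j + 1 : ℕ) : ℤ)) (t₀ + u / R n) / q) +
            εb * (bv (n + j) (t₀ + u / R n)) ^ 2| := by
    intro j _ σ hσ
    have := (hpk (n + j)).2.2.2.2.2.2.2 σ hσ
    simp only [hG1, hc2 j] at this
    exact this
  have h5 : ContinuousOn (fun σ => wv (n + ((1 : ℕ) : ℤ)) (t₀ + σ / R n)) (Icc 0 S') :=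
    (hpk (n + ((1 : ℕ) : ℤ))).2.1
  have h6 : ∀ σ ∈ Icc 0 S', |wv (n + ((1 : ℕ) : ℤ)) (t₀ + σ / R n)| ≤ Y 1 := by
    intro σ hσ
    rw [hY1, Nat.cast_one]
    exact hL1 _ (hmem σ hσ)
  have h7 : ∀ j : ℕ, max J 2 ≤ j → ∀ σ ∈ Icc 0 S', |bv (n + j) (t₀ + σ / R n)| ≤ lad j ∧
      |wv (n + j) (t₀ + σ / R n)| ≤ Y j ∧ M0 (n + j) (t₀ + σ / R n) ≤ lad j ∧
      M1 (n + j) (t₀ + σ / R n) ≤ lad j := by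
    intro j hj σ hσ
    obtain ⟨a1, a2, a3, a4⟩ := hJ j (le_of_max_le_left hj) _ (hmemT σ hσ)
    rw [hYj j (by have := le_of_max_le_right hj; omega)]
    exact ⟨a1, a2, a3, a4⟩
  have h8 : ∀ j : ℕ, 2 ≤ j → |bv (n + j) (t₀ + 0 / R n)| ≤ lad j ∧
      |wv (n + j) (t₀ + 0 / R n)| ≤ Y j ∧ M0 (n + j) (t₀ + 0 / R n) ≤ lad j ∧
      M1 (n + j) (t₀ + 0 / R n) ≤ lad j := by
    intro j hj
    rw [ht00, hYj j (by omega)]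
    exact hInvL j hj
  have key := stub_slavedLadder (fun j σ => bv (n + j) (t₀ + σ / R n))
    (fun j σ => wv (n + j) (t₀ + σ / R n)) (fun j σ => M0 (n + j) (t₀ + σ / R n))
    (fun j σ => M1 (n + j) (t₀ + σ / R n))
    (fun j σ => (db (n + j) (t₀ + σ / R n) -
      R (n + j) * (-(bv (n + j) (t₀ + σ / R n)) + G0 (n + j) (t₀ + σ / R n))) / R n)
    (fun j σ => (dw (n + j) (t₀ + σ / R n) -
      R (n + j) * (-(wv (n + j) (t₀ + σ / R n)) + G1 (n + j) (t₀ + σ / R n))) / R n)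
    lad Y lad lad (fun j => R (n + j) / R n) q θ η εb S' (max J 2) hq1 hθ hθ1 hη hεb hS'0
    (le_max_right _ _) (fun j _ => hκ1 j)
    (fun j _ => ⟨(hlad0 j).le, hY0 j, (hlad0 j).le, (hlad0 j).le⟩)
    (fun j _ => (hladε j).trans (hεb6.trans (by norm_num))) hcl
    (fun j _ => ⟨(hpk (n + j)).1.1, (hpk (n + j)).2.1, (hpk (n + j)).1.2.1, (hpk (n + j)).2.2.1,
      (hpk (n + j)).1.2.2.2.1, (hpk (n + j)).2.2.2.2.1⟩)
    h5 h1 h2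
    (fun j _ σ hσ => ⟨(hpk (n + j)).1.2.2.2.2.2.1 σ hσ, (hpk (n + j)).2.2.2.2.2.2.1 σ hσ⟩)
    h3 h4 h6 h7 h8
  intro j hj
  refine (preBoot_pull (P := fun s => |bv (n + j) s| ≤ lad j ∧ |wv (n + j) s| ≤ lad j / 5 ∧
      M0 (n + j) s ≤ lad j ∧ M1 (n + j) s ≤ lad j) hRn).1 fun σ hσ => ?_
  obtain ⟨k1, k2, k3, k4⟩ := key j hj σ hσ
  rw [hYj j (by omega)] at k2
  exact ⟨k1, k2, k3, k4⟩


/-- **The tight box at the hand-off time.** The hand-off invariant `Inv n B t₀` alone puts every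
mode in its tight pre-ignition box `Pre` at `s = t₀` (`σ = 0`; the relaxation clause of the
previous pair is vacuous since `σ_I > 0`). Registered tools sub-goal `preBoot_pre_t0` of the stub
`preBoot` (the base of the joint continuous induction). [folklore] -/
theorem preBoot_pre_t0 :
    ∀ (ε₀ εb F bhi q B t₀ : ℝ) (n₀ n : ℤ) (lad : ℕ → ℝ) (R : ℤ → ℝ) (bv wv M0 M1 : ℤ → ℝ → ℝ),
      0 < εb → 1 ≤ q → 1 ≤ B → B ≤ bhi → 0 < R n → lad 2 = εb →
      (bv n t₀ = B ∧ (∀ s ∈ Icc 0 t₀, bv n s ≤ B) ∧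
        (0 ≤ wv n t₀ ∧ wv n t₀ ≤ F * εb * B ∧ M1 n t₀ ≤ F * εb * B ∧ M0 n t₀ ≤ 2 * B) ∧
        (n₀ ≤ n - 1 → 0 ≤ wv (n - 1) t₀ ∧ q ^ 3 * B - 1 ≤ (wv (n - 1) t₀) ^ 2 ∧
          (wv (n - 1) t₀) ^ 2 ≤ q ^ 3 * B + 1 ∧ 9 / 20 ≤ bv (n - 1) t₀ ∧ bv (n - 1) t₀ ≤ 11 / 20 ∧
          M0 (n - 1) t₀ ≤ 5 * (bhi + 4) ^ 2 ∧ M1 (n - 1) t₀ ≤ 5 * (bhi + 4) ^ 2) ∧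
        (|bv (n + 1) t₀| ≤ εb ∧ |wv (n + 1) t₀| ≤ εb ∧ M0 (n + 1) t₀ ≤ εb ∧ M1 (n + 1) t₀ ≤ εb) ∧
        (∀ j : ℕ, 2 ≤ j → |bv (n + j) t₀| ≤ lad j ∧ |wv (n + j) t₀| ≤ lad j / 5 ∧
          M0 (n + j) t₀ ≤ lad j ∧ M1 (n + j) t₀ ≤ lad j) ∧
        (∀ j : ℕ, 1 ≤ j → ∀ s ∈ Icc 0 t₀, bv (n + j) s ≤ 1 / 2) ∧
        (∀ k : ℤ, n₀ ≤ k → k ≤ n - 2 → ∃ te ∈ Icc 0 t₀,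
          (-(2 / 5) ≤ bv k te ∧ bv k te ≤ 3 / 10 ∧ |wv k te| ≤ 1 / 200 ∧
            M0 k te ≤ 10 * (bhi + 4) ^ 2 ∧ M1 k te ≤ 10 * (bhi + 4) ^ 2) ∧
          ∀ s ∈ Icc te t₀, -(9 / 20) ≤ bv k s ∧ bv k s ≤ 7 / 20 ∧ |wv k s| ≤ 1 / 100 ∧
            M0 k s ≤ 10 * (bhi + 4) ^ 2 + 1 ∧ M1 k s ≤ 10 * (bhi + 4) ^ 2 + 1 ∧
            |wv (k - 1) s| ≤ 1 / 100 ∧ -(1 / 2) ≤ bv (k + 1) s ∧ bv (k + 1) s ≤ 9 / 10)) →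
      ((B * Real.exp (-(R n * (t₀ - t₀))) - 3 / 2 ≤ bv n t₀ ∧
          bv n t₀ ≤ B * Real.exp (-(R n * (t₀ - t₀))) + 5 / 2 ∧
          0 ≤ wv n t₀ ∧ M0 n t₀ ≤ 6 * (B + 3) ∧
          M1 n t₀ ≤ F * εb * B + 2 * wv n t₀ + 2 * εb * (B + 3) ^ 2 * (R n * (t₀ - t₀))) ∧
        (n₀ ≤ n - 1 → -(1 / 100) ≤ wv (n - 1) t₀ ∧ (wv (n - 1) t₀) ^ 2 ≤ q ^ 3 * B + 2 ∧
          -(2 / 5) ≤ bv (n - 1) t₀ ∧ bv (n - 1) t₀ ≤ 17 / 20 ∧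
          (t₀ + 2 * (100 + 4 * Real.log (bhi + 5)) / (B * R n) ≤ t₀ →
            |wv (n - 1) t₀| ≤ 1 / 200 ∧ bv (n - 1) t₀ ≤ 3 / 10) ∧
          M0 (n - 1) t₀ ≤ 6 * (bhi + 4) ^ 2 ∧ M1 (n - 1) t₀ ≤ 6 * (bhi + 4) ^ 2 ∧
          (1 + ε₀) ^ (-(2 : ℤ)) * R n * ∫ u in t₀..t₀, (wv (n - 1) u) ^ 2 ≤ 9 / 10) ∧
        (|bv (n + 1) t₀| ≤ εb + q / 100 + 1 / 10 ^ 3 ∧ |wv (n + 1) t₀| ≤ 11 / 10 * εb ∧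
          M0 (n + 1) t₀ ≤ εb + (B + 3) / 40 ∧ M1 (n + 1) t₀ ≤ 4 * εb) ∧
        (∀ j : ℕ, 2 ≤ j → |bv (n + j) t₀| ≤ lad j ∧ |wv (n + j) t₀| ≤ lad j / 5 ∧
          M0 (n + j) t₀ ≤ lad j ∧ M1 (n + j) t₀ ≤ lad j) ∧
        (∀ k : ℤ, n₀ ≤ k → k ≤ n - 2 → -(9 / 20) ≤ bv k t₀ ∧ bv k t₀ ≤ 7 / 20 ∧
          |wv k t₀| ≤ 1 / 100 ∧ M0 k t₀ ≤ 10 * (bhi + 4) ^ 2 + 1 ∧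
          M1 k t₀ ≤ 10 * (bhi + 4) ^ 2 + 1)) := by
  rintro ε₀ εb F bhi q B t₀ n₀ n lad R bv wv M0 M1 hεb hq1 hB1 hBhi hRn -
    ⟨hb, -, ⟨hw0, hwF, hM1, hM0⟩, hP, ⟨h1b, h1w, h1m0, h1m1⟩, hL, -, hTr⟩
  have h00 : R n * (t₀ - t₀) = 0 := by simp
  have hq0 : 0 < q := by linarith
  have hΛ : 0 < 2 * (100 + 4 * Real.log (bhi + 5)) / (B * R n) := by
    have : 0 ≤ Real.log (bhi + 5) := Real.log_nonneg (by linarith)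
    positivity
  refine ⟨?_, fun hn1 => ?_, ⟨by linarith [hq0.le], by linarith, by linarith, by linarith⟩, hL,
    fun k hk1 hk2 => ?_⟩
  · rw [h00, neg_zero, Real.exp_zero, mul_one, mul_zero, add_zero, hb]
    have : 0 ≤ F * εb * B := by nlinarith [mul_nonneg (le_trans hw0 hwF) zero_le_one]
    exact ⟨by linarith, by linarith, hw0, by linarith, by linarith⟩
  · obtain ⟨p1, -, p3, p4, p5, p6, p7⟩ := hP hn1
    have hsq : 0 ≤ (bhi + 4) ^ 2 := sq_nonneg _
    refine ⟨by linarith, by linarith, by linarith, by linarith, fun h => absurd h (by linarith),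
      by linarith, by linarith, ?_⟩
    rw [intervalIntegral.integral_same, mul_zero]
    norm_num
  · obtain ⟨te, hte, -, hbox⟩ := hTr k hk1 hk2
    obtain ⟨a1, a2, a3, a4, a5, -⟩ := hbox t₀ ⟨hte.2, le_rfl⟩
    exact ⟨a1, a2, a3, a4, a5⟩

end Summit.NavierStokesRegularity.NavierStokesRegularity.Theorems.PerpetualPumpAveragedTypeIBlowup

end
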